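import Literature.NumberTheory.LFunctions.ConreyIwaniec2002ThetaVoronoiDefs
import Literature.NumberTheory.QuadraticFields.QuadraticDedekindZeta
import Literature.NumberTheory.QuadraticFields.ImaginaryResiduePiForm
import Literature.NumberTheory.QuadraticFields.GenusCharacterFactorization
import Literature.NumberTheory.LFunctions.PrimitiveQuadraticCharacterKronecker
import Literature.NumberTheory.LFunctions.PrimitiveQuadraticCharacterModulus
import Mathlib.RingTheory.IntegralDomain
import HarnessLib

/-!
# Conrey–Iwaniec (2002), §§2–4: the leading constant of the weight-one summation formula for `θ(z;ψ)`

B. Conrey, H. Iwaniec, *Spacing of zeros of Hecke `L`-functions and the class number problem*,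
Acta Arith. 103 (2002), §2 (2.12)–(2.13), (2.17), (2.19), §4 (4.21) [held text
`paper:arxiv-math_0111012`, p0006, p0012]: `λ_ψ(0) = δ_ψh/2` (2.17), `h = π⁻¹√q·L(1,χ)` (2.12),
"any real character `ψ ∈ Ĉl(K)` is given uniquely by `ψ(𝔭) = χ_v(N𝔭)`" (2.19), and
`p(c) = (L(1,χ)/c)·√v` if `(c,q) = v`, `·√w` if `(c,q) = w`, `0` otherwise (4.21). Registered stub
V3 `stub_theta_constants` of SUB-SKELETON S3d (cell `landau-siegel/ls-inputs`, sub-line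
`theta-voronoi`), PROVED: for `ψ'` with `ψ'ψ⁻¹` the genus character of `s = (c,q)` (by values),
`(2π/(c√(q/s)))·½Σ_𝒜ψ'(𝒜) = p(c)` with `p = voronoiMainCoeff q |L(1,χ)| ψ` — by orthogonality
(`Σ_𝒜ψ'(𝒜) = h·[ψ' = 1]`, Mathlib `sum_hom_units_eq_zero`), genus theory (`ψ' = 1 ⟺ ψ` is the genus
character of `s`: a class-group character is determined by its values at the primes of norm prime to
`s`, the tree's `classGroupChar_eq_one_of_primeValue`, and `(N𝔭/s) = ±1` there), Dirichlet's class
number formula `L(1,χ) = πh/√q` for `d_K = −q < −4` (the tree's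
`LFunction_jacobiChar_one_eq_of_discr_neg`, `torsionOrder_eq_two_of_discr_lt_neg_four`, with
`χ = (·/q)` by `apply_natCast_eq_jacobiSym_neg_of_odd` and reciprocity), and `√q = √(q/s)·√s`.

## References

* [ConreyIwaniec2002] B. Conrey, H. Iwaniec, Acta Arith. 103 (2002) 259–312, arXiv:math/0111012:
  §2 (2.12)–(2.13), (2.17), (2.19); §4 (4.21).
-/

noncomputable section

open scoped NumberField NumberTheorySymbols
open Complex NumberField IsDedekindDomain

namespace Literature.NumberTheory.LFunctions

namespace ConreyIwaniec2002

open Literature.NumberTheory.LFunctions.NumberField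
open Literature.NumberTheory.QuadraticFields (jacobiChar jacobiChar_natCast
  jacobiSym_natAbs_eq_of_emod_four_eq_one)
open Literature.NumberTheory.QuadraticFields.Quadratic (classGroupChar_eq_one_of_primeValue
  LFunction_jacobiChar_one_eq_of_discr_neg torsionOrder_eq_two_of_discr_lt_neg_four)
open Literature.NumberTheory.LFunctions.PrimitiveQuadratic (apply_natCast_eq_jacobiSym_neg_of_odd
  mod_four_eq_three_of_odd)

variable {K : Type*} [Field K] [NumberField K]

/-- The value of a product / inverse of class-group characters at a prime. [folklore] -/
private theorem primeValue_mul (ψ₁ ψ₂ : ClassGroup (𝓞 K) →* ℂˣ) (v : HeightOneSpectrum (𝓞 K)) :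
    classGroupCharPrimeValue (ψ₁ * ψ₂) v = classGroupCharPrimeValue ψ₁ v * classGroupCharPrimeValue ψ₂ v := by
  simp only [classGroupCharPrimeValue_apply, MonoidHom.mul_apply, Units.val_mul]

/-- The value at a prime is a unit. [folklore] -/
private theorem primeValue_ne_zero (ψ : ClassGroup (𝓞 K) →* ℂˣ) (v : HeightOneSpectrum (𝓞 K)) :
    classGroupCharPrimeValue ψ v ≠ 0 := by
  rw [classGroupCharPrimeValue_apply]; exact Units.ne_zero _

/-- `ψ⁻¹(𝔭) · ψ(𝔭) = 1`. [folklore] -/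
private theorem primeValue_inv_mul (ψ : ClassGroup (𝓞 K) →* ℂˣ) (v : HeightOneSpectrum (𝓞 K)) :
    classGroupCharPrimeValue ψ⁻¹ v * classGroupCharPrimeValue ψ v = 1 := by
  rw [classGroupCharPrimeValue_apply, classGroupCharPrimeValue_apply, MonoidHom.inv_apply,
    ← Units.val_mul, inv_mul_cancel, Units.val_one]

/-- The trivial character has value `1` at every prime. [folklore] -/
private theorem primeValue_one (v : HeightOneSpectrum (𝓞 K)) :
    classGroupCharPrimeValue (1 : ClassGroup (𝓞 K) →* ℂˣ) v = 1 := by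
  rw [classGroupCharPrimeValue_apply, MonoidHom.one_apply, Units.val_one]

/-- For `(n, D) = 1` the Jacobi symbol `(n/D)` squares to `1` (as a complex number). [folklore] -/
private theorem jacobiSym_sq_eq_one_of_coprime {n D : ℕ} (h : n.Coprime D) :
    ((J((n : ℤ) | D) : ℂ)) ^ 2 = 1 := by
  have h1 : J((n : ℤ) | D) ^ 2 = 1 := jacobiSym.sq_one (by rwa [Int.gcd_natCast_natCast])
  exact_mod_cast congrArg (fun z : ℤ ↦ (z : ℂ)) h1

/-- **Genus dichotomy**: if `ψ'ψ⁻¹` is the genus character of `D` (`D ≠ 0`, by values), then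
`ψ' = 1 ⟺ ψ` is the genus character of `D`. [cite: ConreyIwaniec2002, §2 (2.19)] -/
theorem genusChar_eq_one_iff {ψ ψ' : ClassGroup (𝓞 K) →* ℂˣ} {D : ℕ} (hD : D ≠ 0)
    (hg : IsGenusCharFor (ψ' * ψ⁻¹) D) : ψ' = 1 ↔ IsGenusCharFor ψ D := by
  constructor
  · intro h1 v hv
    have h := hg v hv
    rw [primeValue_mul, h1, primeValue_one, one_mul] at h
    -- `ψ⁻¹(𝔭) = J`, `J² = 1` ⇒ `ψ(𝔭) = J`
    have hJ := jacobiSym_sq_eq_one_of_coprime hv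
    have hinv := primeValue_inv_mul ψ v
    rw [h] at hinv
    have hJne : (J(((Ideal.absNorm v.asIdeal : ℕ) : ℤ) | D) : ℂ) ≠ 0 := fun h0 ↦ by
      rw [h0, zero_pow two_ne_zero] at hJ; exact zero_ne_one hJ
    calc classGroupCharPrimeValue ψ v
        = (J(((Ideal.absNorm v.asIdeal : ℕ) : ℤ) | D) : ℂ) ^ 2 * classGroupCharPrimeValue ψ v := by
          rw [hJ, one_mul]
      _ = (J(((Ideal.absNorm v.asIdeal : ℕ) : ℤ) | D) : ℂ) := by
          rw [pow_two, mul_assoc, hinv, mul_one]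
  · intro hψ
    refine classGroupChar_eq_one_of_primeValue hD ψ' fun v hv ↦ ?_
    have h := hg v hv
    rw [primeValue_mul] at h
    have hJ := jacobiSym_sq_eq_one_of_coprime hv
    have hψv := hψ v hv
    -- `ψ'(𝔭) = (ψ'ψ⁻¹)(𝔭)·ψ(𝔭) = J·J = 1`
    have hinv := primeValue_inv_mul ψ v
    calc classGroupCharPrimeValue ψ' v
        = classGroupCharPrimeValue ψ' v * (classGroupCharPrimeValue ψ⁻¹ v *
            classGroupCharPrimeValue ψ v) := by rw [hinv, mul_one]
      _ = (classGroupCharPrimeValue ψ' v * classGroupCharPrimeValue ψ⁻¹ v) *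
            classGroupCharPrimeValue ψ v := by ring
      _ = 1 := by rw [h, hψv, ← pow_two, hJ]

/-- `Σ_𝒜 ψ(𝒜) = h·[ψ = 1]` (orthogonality). [cite: ConreyIwaniec2002, §2 (2.13), (2.17)] -/
theorem thetaConst_eq (ψ : ClassGroup (𝓞 K) →* ℂˣ) :
    thetaConst K ψ = if ψ = 1 then ((Fintype.card (ClassGroup (𝓞 K)) : ℂ)) / 2 else 0 := by
  classical
  unfold thetaConst
  split_ifs with h1
  · subst h1
    simp only [MonoidHom.one_apply, Units.val_one, Finset.sum_const, Finset.card_univ,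
      nsmul_eq_mul, mul_one]
    ring
  · have hne : (Units.coeHom ℂ).comp ψ ≠ 1 := by
      intro h
      apply h1
      ext A
      have := DFunLike.congr_fun h A
      simpa [Units.coeHom_apply] using this
    have h0 : ∑ A : ClassGroup (𝓞 K), ((ψ A : ℂˣ) : ℂ) = 0 := by
      have := sum_hom_units_eq_zero ((Units.coeHom ℂ).comp ψ) hne
      simpa [Units.coeHom_apply] using this
    rw [h0, mul_zero]

/-- **The odd primitive quadratic character mod `q` is the Jacobi character `(·/q)`**
(`q ≡ 3 (mod 4)`; Montgomery–Vaughan Thm. 9.13 with reciprocity). [folklore] -/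
private theorem eq_jacobiChar {q : ℕ} [NeZero q] (hodd : Odd q) {χ : DirichletCharacter ℂ q}
    (hprim : χ.IsPrimitive) (hquad : χ.IsQuadratic) (hχ : χ.Odd) : χ = jacobiChar q := by
  have hq3 := mod_four_eq_three_of_odd hodd hprim hquad hχ
  have hD4 : (-(q : ℤ)) % 4 = 1 := by omega
  refine MulChar.ext fun u ↦ ?_
  obtain ⟨r, hr, hru⟩ : ∃ r : ℕ, Odd r ∧ (r : ZMod q) = u := by
    by_cases hpar : Odd (u : ZMod q).val
    · exact ⟨_, hpar, ZMod.natCast_zmod_val _⟩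
    · refine ⟨(u : ZMod q).val + q, (Nat.not_odd_iff_even.mp hpar).add_odd hodd, ?_⟩
      rw [Nat.cast_add, ZMod.natCast_self, add_zero, ZMod.natCast_zmod_val]
  rw [← hru, apply_natCast_eq_jacobiSym_neg_of_odd hprim hquad hχ hr, jacobiChar_natCast]
  have h := jacobiSym_natAbs_eq_of_emod_four_eq_one hD4 hr
  rw [show (-(q : ℤ)).natAbs = q by simp] at h
  rw [h]

/-- **Dirichlet's class number formula for `d_K = −q < −4`** in the form `π·h = √q·|L(1,χ)|`,
`χ` the odd primitive quadratic character mod `q` ((2.12): `h = π⁻¹√qL(1,χ)`).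
[cite: ConreyIwaniec2002, §2 (2.12)] -/
theorem pi_mul_card_classGroup_eq {q : ℕ} [NeZero q] (hq : 4 < q) (hodd : Odd q)
    {χ : DirichletCharacter ℂ q} (hprim : χ.IsPrimitive) (hquad : χ.IsQuadratic) (hχ : χ.Odd)
    (K : Type) [Field K] [NumberField K] (h2 : Module.finrank ℚ K = 2)
    (hdisc : NumberField.discr K = -(q : ℤ)) :
    Real.pi * (Fintype.card (ClassGroup (𝓞 K)) : ℝ) = Real.sqrt q * ‖χ.LFunction 1‖ := by
  have hq0 : (0 : ℝ) < q := by exact_mod_cast (show 0 < q by omega)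
  have hoddD : Odd (NumberField.discr K) := by
    obtain ⟨k, hk⟩ := hodd
    rw [hdisc, hk]
    exact ⟨-(k : ℤ) - 1, by push_cast; ring⟩
  have hneg : NumberField.discr K < 0 := by rw [hdisc]; omega
  have hneg4 : NumberField.discr K < -4 := by rw [hdisc]; omega
  have hL := LFunction_jacobiChar_one_eq_of_discr_neg h2 hoddD hneg
  have hnat : (NumberField.discr K).natAbs = q := by rw [hdisc]; simp
  -- transport along `|d_K| = q` (the level is a dependent index)
  have hL' : ∀ (m : ℕ) [NeZero m], (NumberField.discr K).natAbs = m →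
      (jacobiChar m).LFunction 1 =
        ((2 * Real.pi * classNumber K /
          (Units.torsionOrder K * Real.sqrt |(NumberField.discr K : ℝ)|) : ℝ) : ℂ) := by
    intro m _ hm
    subst hm
    exact hL
  have hLq := hL' q hnat
  rw [torsionOrder_eq_two_of_discr_lt_neg_four h2 hneg4] at hLq
  have habs : |(NumberField.discr K : ℝ)| = q := by
    rw [hdisc]; push_cast; rw [abs_neg, abs_of_nonneg hq0.le]
  rw [habs] at hLq
  rw [eq_jacobiChar hodd hprim hquad hχ, hLq, Complex.norm_real, Real.norm_eq_abs,
    abs_of_nonneg (by positivity)]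
  have hsq : Real.sqrt q ≠ 0 := (Real.sqrt_pos.mpr hq0).ne'
  rw [show classNumber K = Fintype.card (ClassGroup (𝓞 K)) from rfl]
  field_simp
  ring

/-- **V3 — the leading constant** (registered stub `stub_theta_constants` of SUB-SKELETON S3d,
statement verbatim): `(2π/(c√(q/s)))·½Σ_𝒜ψ'(𝒜) = voronoiMainCoeff q |L(1,χ)| ψ c` whenever
`ψ'ψ⁻¹` is the genus character of `s = (c,q)`. [cite: ConreyIwaniec2002, §2 (2.12)–(2.13), (2.17), (2.19); §4 (4.21)] -/
theorem theta_constants :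
    ∀ (q : ℕ) [NeZero q], 4 < q → Odd q → ∀ χ : DirichletCharacter ℂ q,
      χ.IsPrimitive → χ.IsQuadratic → χ.Odd →
        ∀ (K : Type) [Field K] [NumberField K],
          Module.finrank ℚ K = 2 → NumberField.discr K = -(q : ℤ) →
            ∀ (ψ ψ' : ClassGroup (𝓞 K) →* ℂˣ) (c : ℕ), 1 ≤ c →
              IsGenusCharFor (ψ' * ψ⁻¹) (Nat.gcd c q) →
                ((2 * Real.pi / ((c : ℝ) * Real.sqrt (q / Nat.gcd c q : ℕ)) : ℝ) : ℂ) * thetaConst K ψ' =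
                  ((voronoiMainCoeff q ‖χ.LFunction 1‖ ψ c : ℝ) : ℂ) := by
  intro q _ hq hodd χ hprim hquad hoddχ K _ _ h2 hdisc ψ ψ' c hc hg
  classical
  have hq0 : 0 < q := by omega
  have hs0 : Nat.gcd c q ≠ 0 := (Nat.gcd_pos_of_pos_right c hq0).ne'
  have hsq : Nat.gcd c q ∣ q := Nat.gcd_dvd_right c q
  have hrs : (q / Nat.gcd c q) * Nat.gcd c q = q := Nat.div_mul_cancel hsq
  have hc0 : (0 : ℝ) < c := by exact_mod_cast hc
  have hs0R : (0 : ℝ) < (Nat.gcd c q : ℕ) := by exact_mod_cast Nat.pos_of_ne_zero hs0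
  have hr0R : (0 : ℝ) < (q / Nat.gcd c q : ℕ) := by
    have : 0 < q / Nat.gcd c q := Nat.div_pos (Nat.le_of_dvd hq0 hsq) (Nat.pos_of_ne_zero hs0)
    exact_mod_cast this
  have hiff : ψ' = 1 ↔ IsGenusCharFor ψ (Nat.gcd c q) := genusChar_eq_one_iff hs0 hg
  have hCNF := pi_mul_card_classGroup_eq hq hodd hprim hquad hoddχ K h2 hdisc
  rw [thetaConst_eq]
  unfold voronoiMainCoeff
  simp only [Set.indicator_apply, Set.mem_setOf_eq]
  by_cases hψ : IsGenusCharFor ψ (Nat.gcd c q)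
  · rw [if_pos (hiff.mpr hψ), if_pos hψ]
    -- `(2π/(c√r))·(h/2) = √s·ℓ/c` with `πh = √q·ℓ`, `√q = √r·√s`
    have hsqrt : Real.sqrt q = Real.sqrt (q / Nat.gcd c q : ℕ) * Real.sqrt (Nat.gcd c q : ℕ) := by
      rw [← Real.sqrt_mul hr0R.le, ← Nat.cast_mul, hrs]
    have hr' : Real.sqrt (q / Nat.gcd c q : ℕ) ≠ 0 := (Real.sqrt_pos.mpr hr0R).ne'
    have hreal : 2 * Real.pi / ((c : ℝ) * Real.sqrt (q / Nat.gcd c q : ℕ)) *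
        ((Fintype.card (ClassGroup (𝓞 K)) : ℝ) / 2) =
        Real.sqrt (Nat.gcd c q : ℕ) * ‖χ.LFunction 1‖ / c := by
      rw [hsqrt] at hCNF
      field_simp
      linear_combination hCNF
    have hcast : ((2 * Real.pi / ((c : ℝ) * Real.sqrt (q / Nat.gcd c q : ℕ)) : ℝ) : ℂ) *
        (((Fintype.card (ClassGroup (𝓞 K)) : ℕ) : ℂ) / 2) =
        ((2 * Real.pi / ((c : ℝ) * Real.sqrt (q / Nat.gcd c q : ℕ)) *
          ((Fintype.card (ClassGroup (𝓞 K)) : ℝ) / 2) : ℝ) : ℂ) := by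
      push_cast; ring
    rw [hcast, hreal]
  · rw [if_neg (fun h ↦ hψ (hiff.mp h)), if_neg hψ, mul_zero, Complex.ofReal_zero]

end ConreyIwaniec2002

end Literature.NumberTheory.LFunctions

end
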